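import Summits.HodgeConjecture.HodgeConjecture.Theses.LimitExtension
import Literature.AlgebraicGeometry.HodgeTheory.HypersurfaceLefschetzUpper
import Literature.AlgebraicGeometry.HodgeTheory.ComplexConjugationHolds
import Literature.AlgebraicGeometry.HodgeTheory.CubicFourfoldHodgeConjectureChowZero
import Literature.AlgebraicGeometry.HodgeTheory.QuarticQuinticFourfoldHodgeClassesAlgebraic

/-!
# Route LimitExtension — `HypersurfaceHodgeFourLowDegree` (item stmt-HodgeConjecture-3003)

The support item `HypersurfaceHodgeFourLowDegree` of route `HodgeConjecture/LimitExtension`: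
for every `d ≤ 5` and every smooth hypersurface fourfold `X ⊂ ℙ⁵_ℂ` of degree `d`
(`Motives.IsSmoothHypersurface 4 d X`), `HodgeConjectureFor 4 X` — a Hodge model exists AND every
rational `(p,p)`-class of `H²ᵖ(X(ℂ); ℂ)` is algebraic, for every `p`.

## What is proved here (no `sorry`, no new axiom)

* `limitExtension_hypersurfaceHodgeFour_of_twoTwo` — **reduction to the middle degree, for ONE
  smooth hypersurface fourfold of any degree**: `HodgeConjectureFor 4 X` follows from the single
  slice "rational `(2,2)`-classes of `H⁴(X(ℂ); ℂ)` are algebraic". Everything else is a THEOREM of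
  the tree: the Hodge model (`nonempty_hodgeModel_holds`: Serre GAGA + de Rham + the Hodge
  decomposition of compact Kähler manifolds) and all degrees `2p ≠ 4` (the discharged Lefschetz
  theorem for smooth hypersurfaces `Voisin2003_smoothHypersurface_algebraicClasses_eq_top_holds`:
  `H²ᵖ(X(ℂ); ℂ) = ℂ·hᵖ` for `p = 1, 3`, classes of points for `p = 4`, `H⁰` and `H^{>8} = 0`).
* `limitExtension_hypersurfaceHodgeFourLowDegree_iff_twoTwo` — hence the item is EQUIVALENT to its
  `(2,2)`-slice over the degrees `d ≤ 5`.
* `limitExtension_hypersurfaceHodgeFourLowDegree_twoTwo_of_le_four` — the `(2,2)`-slice for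
  `d ≤ 4` from the named fact `BlochSrinivas1983_hodgeConjectureDegreeFour_of_chowZeroSupported`
  (Voisin II, Prop. 10.26) ALONE: `d = 0` is vacuous (no irreducible form of degree `0`), and for
  `1 ≤ d ≤ 4` a line passes through every point (`d + 1 ≤ 5`), so `CH₀(X)` is supported on a
  hyperplane section — PROVED in the tree
  (`mem_algebraicClasses_two_of_isSmoothHypersurface_four_of_blochSrinivas`). This covers `ℙ⁴`,
  quadric, cubic (Zucker 1977 / Murre 1977) and quartic (Conte–Murre 1978) fourfolds.
* `limitExtension_hypersurfaceHodgeFourLowDegree_of_blochSrinivas` — **the item from Prop. 10.26 and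
  the `CH₀`-support of smooth quintic fourfolds** (`HasChowZeroSupportedInDimLE X 3` for
  `IsSmoothHypersurface 4 5 X`: the quintic fourfold is Fano, covered by conics, so every point is
  rationally equivalent to a point of an ample hypersurface section — Voisin's remark after
  Prop. 10.26), both explicit hypotheses.
* `limitExtension_hypersurfaceHodgeFourLowDegree_of_quintic` — the item from Prop. 10.26 and the
  `(2,2)`-slice for smooth quintic fourfolds, both explicit hypotheses.

The degree-`5` input is the printed theorem "the Hodge (2,2)-conjecture is true for smooth `V(3)`,
`V(4)` and `V(5)` in `ℙ₅`" (Conte–Murre 1978/1980, quoted in Murre's Torino lectures, LNM 1594,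
§5.3.1), proposed `B`-free as the Literature named fact
`Literature.AlgebraicGeometry.HodgeTheory.hodgeTwoTwo_algebraic_quarticQuinticFourfold`
(`HodgeTheory/QuarticQuinticFourfoldHodgeClassesAlgebraic`); once it is in the tree, `…_of_quintic`
specialises to the item CLOSED MODULO the two named facts
`Literature.Barriers.HodgeConjecture.BlochSrinivas1983_hodgeConjectureDegreeFour_of_chowZeroSupported`
(whose discharge in `DecompositionOfTheDiagonalDegreeFourOfGysin` awaits the Gysin / cycle-class
construction on `H*(X(ℂ); ℂ)`) and that fact.
-/

-- `Summit.HodgeConjecture.HodgeConjecture.Theorems` is the mandated namespace (single-problem summit: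
-- Problem = Summit), which `linter.dupNamespace` flags on every declaration; the lakefile turns the
-- linter off tree-wide (weak option), restated here so stand-alone elaboration is warning-free too.
set_option linter.dupNamespace false

noncomputable section

namespace Summit.HodgeConjecture.HodgeConjecture.Theorems

open Literature.AlgebraicGeometry.HodgeTheory Literature.AlgebraicGeometry.Motives
  Literature.Barriers.HodgeConjecture
open Summit.HodgeConjecture.HodgeConjecture.Theses.LimitExtension

/-! ### Reduction to the `(2,2)`-slice (unconditional) -/

/-- **The Hodge conjecture for a smooth hypersurface fourfold reduces to its `(2,2)`-part.** For a
smooth hypersurface `X ⊂ ℙ⁵_ℂ` of dimension `4` (any degree `d`), if every rational `(2,2)`-class of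
`H⁴(X(ℂ); ℂ)` is algebraic then `HodgeConjectureFor 4 X`: the Hodge model is
`nonempty_hodgeModel_holds`, and in every degree `2p ≠ 4` ALL classes are algebraic by the
discharged Lefschetz theorem for smooth hypersurfaces
(`Voisin2003_smoothHypersurface_algebraicClasses_eq_top_holds`, with `p = 0`, `p = 4` and `p > 4`
the tree's `algebraicClasses_zero`, top-degree and vanishing lemmas, assembled in
`Voisin2003_smoothHypersurface_algebraicClasses_eq_top.mem_algebraicClasses`).
[cite: VoisinHodgeII2003, Cor. 1.24 and Cor. 1.25] [cite: Murre1977, Remark 1 (p. 230)] -/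
theorem limitExtension_hypersurfaceHodgeFour_of_twoTwo {d : ℕ} {X : SchemeOver ℂ}
    (hX : IsSmoothHypersurface 4 d X)
    (h22 : ∀ c : complexBetti X (2 * 2), IsRationalClass c → IsOfHodgeType 4 X (2 * 2) 2 2 c →
      c ∈ algebraicClasses X 2) :
    HodgeConjectureFor 4 X := by
  refine ⟨nonempty_hodgeModel_holds hX.1, fun p c hc hpp ↦ ?_⟩
  by_cases hp : p = 2
  · subst hp
    exact h22 c hc hpp
  · exact Voisin2003_smoothHypersurface_algebraicClasses_eq_top_holds.mem_algebraicClasses hX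
      (by omega) c

/-- **The item from its `(2,2)`-slice**: if for every `d ≤ 5` every rational `(2,2)`-class on every
smooth hypersurface fourfold of degree `d` is algebraic, then `HypersurfaceHodgeFourLowDegree`.
[cite: VoisinHodgeII2003, Cor. 1.24 and Cor. 1.25] -/
theorem limitExtension_hypersurfaceHodgeFourLowDegree_of_twoTwo
    (h22 : ∀ ⦃d : ℕ⦄ ⦃X : SchemeOver ℂ⦄, d ≤ 5 → IsSmoothHypersurface 4 d X →
      ∀ c : complexBetti X (2 * 2), IsRationalClass c → IsOfHodgeType 4 X (2 * 2) 2 2 c →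
        c ∈ algebraicClasses X 2) :
    HypersurfaceHodgeFourLowDegree := by
  unfold HypersurfaceHodgeFourLowDegree
  intro d X hd hX
  exact limitExtension_hypersurfaceHodgeFour_of_twoTwo hX (h22 hd hX)

/-- Conversely the item contains its `(2,2)`-slice (the `p = 2` component of `HodgeConjectureFor`).
[cite: Deligne2000, §1] -/
theorem limitExtension_twoTwo_of_hypersurfaceHodgeFourLowDegree
    (h : HypersurfaceHodgeFourLowDegree) ⦃d : ℕ⦄ ⦃X : SchemeOver ℂ⦄ (hd : d ≤ 5)
    (hX : IsSmoothHypersurface 4 d X) (c : complexBetti X (2 * 2)) (hc : IsRationalClass c)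
    (hpp : IsOfHodgeType 4 X (2 * 2) 2 2 c) : c ∈ algebraicClasses X 2 :=
  (h hd hX).2 2 c hc hpp

/-- **The item is equivalent to its `(2,2)`-slice**: the Hodge conjecture for smooth hypersurface
fourfolds of degree `≤ 5` holds iff, for each such `X`, every rational `(2,2)`-class of
`H⁴(X(ℂ); ℂ)` is algebraic. [cite: VoisinHodgeII2003, Cor. 1.24 and Cor. 1.25] [cite: Deligne2000, §1] -/
theorem limitExtension_hypersurfaceHodgeFourLowDegree_iff_twoTwo :
    HypersurfaceHodgeFourLowDegree ↔
      ∀ ⦃d : ℕ⦄ ⦃X : SchemeOver ℂ⦄, d ≤ 5 → IsSmoothHypersurface 4 d X →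
        ∀ c : complexBetti X (2 * 2), IsRationalClass c → IsOfHodgeType 4 X (2 * 2) 2 2 c →
          c ∈ algebraicClasses X 2 :=
  ⟨fun h _ _ hd hX ↦ limitExtension_twoTwo_of_hypersurfaceHodgeFourLowDegree h hd hX,
    limitExtension_hypersurfaceHodgeFourLowDegree_of_twoTwo⟩

/-! ### Degree `0` is vacuous -/

/-- There is no smooth hypersurface of degree `0`: an irreducible form has positive degree
(`pos_of_irreducible_isHomogeneous`). [cite: Hartshorne1977, I Ex. 5.9 and II.8.20.3] -/
theorem limitExtension_not_isSmoothHypersurface_zero {n : ℕ} {X : SchemeOver ℂ}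
    (hX : IsSmoothHypersurface n 0 X) : False := by
  obtain ⟨-, F, hF, hirr, -⟩ := hX
  exact (Nat.lt_irrefl 0) (pos_of_irreducible_isHomogeneous hF hirr)

/-! ### The `(2,2)`-slice for `d ≤ 4` from Prop. 10.26 (lines through every point) -/

/-- **Degrees `d ≤ 4` from Prop. 10.26 alone.** Granted
`BlochSrinivas1983_hodgeConjectureDegreeFour_of_chowZeroSupported` (Voisin II, Prop. 10.26), every
rational `(2,2)`-class on a smooth hypersurface fourfold of degree `d ≤ 4` is algebraic: `d = 0` is
vacuous and for `1 ≤ d ≤ 4` a line passes through every point of `X` (`d + 1 ≤ 5`), so `CH₀(X)` is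
supported on a hyperplane section — proved in the tree
(`mem_algebraicClasses_two_of_isSmoothHypersurface_four_of_blochSrinivas`). Covers `ℙ⁴`, the smooth
quadric, cubic (Zucker 1977; Murre 1977) and quartic (Conte–Murre 1978) fourfolds.
[cite: VoisinHodgeII2003, Prop. 10.26 and the remark following it (§10.2.3)]
[cite: Zucker1977, (3.2) Theorem, p. 206] [cite: ConteMurre1978] -/
theorem limitExtension_hypersurfaceHodgeFourLowDegree_twoTwo_of_le_four
    (hBS : BlochSrinivas1983_hodgeConjectureDegreeFour_of_chowZeroSupported) ⦃d : ℕ⦄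
    ⦃X : SchemeOver ℂ⦄ (hd : d ≤ 4) (hX : IsSmoothHypersurface 4 d X) (c : complexBetti X (2 * 2))
    (hc : IsRationalClass c) (hpp : IsOfHodgeType 4 X (2 * 2) 2 2 c) : c ∈ algebraicClasses X 2 := by
  rcases Nat.eq_zero_or_pos d with rfl | hd0
  · exact (limitExtension_not_isSmoothHypersurface_zero hX).elim
  · exact mem_algebraicClasses_two_of_isSmoothHypersurface_four_of_blochSrinivas hBS hX hd0 hd c hc hpp

/-! ### The item, conditionally -/

/-- **`HypersurfaceHodgeFourLowDegree` from Prop. 10.26 and the `CH₀`-support of smooth quintic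
fourfolds.** Hypotheses: `hBS`, the named fact
`BlochSrinivas1983_hodgeConjectureDegreeFour_of_chowZeroSupported` (Voisin II, Prop. 10.26); `hCH₅`,
for every smooth quintic fourfold `X ⊂ ℙ⁵_ℂ`, `CH₀(X)` is supported on a closed algebraic subset of
dimension `≤ 3` (the quintic fourfold is Fano, hence covered by rational curves — conics — and all
its points are rationally equivalent to points of an ample hypersurface section, Voisin's remark
after Prop. 10.26; not vendored as a named fact here). Then degrees `d ≤ 4` are
`…_twoTwo_of_le_four`, degree `5` is Prop. 10.26 applied to `hCH₅`, and the other codimensions and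
the Hodge model are theorems of the tree (`…_of_twoTwo`).
[cite: VoisinHodgeII2003, Prop. 10.26 and the remark following it (§10.2.3)] [cite: ConteMurre1978] -/
theorem limitExtension_hypersurfaceHodgeFourLowDegree_of_blochSrinivas
    (hBS : BlochSrinivas1983_hodgeConjectureDegreeFour_of_chowZeroSupported)
    (hCH₅ : ∀ ⦃X : SchemeOver ℂ⦄, IsSmoothHypersurface 4 5 X → HasChowZeroSupportedInDimLE X 3) :
    HypersurfaceHodgeFourLowDegree := by
  refine limitExtension_hypersurfaceHodgeFourLowDegree_of_twoTwo fun d X hd hX c hc hpp ↦ ?_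
  rcases hd.lt_or_eq with hlt | rfl
  · exact limitExtension_hypersurfaceHodgeFourLowDegree_twoTwo_of_le_four hBS (by omega) hX c hc hpp
  · exact hBS hX.1 (hCH₅ hX) c hc hpp

/-- **`HypersurfaceHodgeFourLowDegree` from Prop. 10.26 and the `(2,2)`-conjecture for smooth quintic
fourfolds** (Conte–Murre 1978, through their covering family of conics), both explicit hypotheses:
degrees `d ≤ 4` by `…_twoTwo_of_le_four`, degree `5` by `h₅`, everything else by `…_of_twoTwo`.
[cite: VoisinHodgeII2003, Prop. 10.26 and the remark following it (§10.2.3)] [cite: ConteMurre1978] -/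
theorem limitExtension_hypersurfaceHodgeFourLowDegree_of_quintic
    (hBS : BlochSrinivas1983_hodgeConjectureDegreeFour_of_chowZeroSupported)
    (h₅ : ∀ ⦃X : SchemeOver ℂ⦄, IsSmoothHypersurface 4 5 X →
      ∀ c : complexBetti X (2 * 2), IsRationalClass c → IsOfHodgeType 4 X (2 * 2) 2 2 c →
        c ∈ algebraicClasses X 2) :
    HypersurfaceHodgeFourLowDegree := by
  refine limitExtension_hypersurfaceHodgeFourLowDegree_of_twoTwo fun d X hd hX c hc hpp ↦ ?_
  rcases hd.lt_or_eq with hlt | rfl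
  · exact limitExtension_hypersurfaceHodgeFourLowDegree_twoTwo_of_le_four hBS (by omega) hX c hc hpp
  · exact h₅ hX c hc hpp

/-- **Upper bound (sanity): the item is an instance of the Hodge conjecture** — if every smooth
projective complex variety satisfies `HodgeConjectureFor`, then so does every smooth hypersurface
fourfold of degree `≤ 5`; nothing beyond the summit statement is claimed by the item.
[cite: Deligne2000, §1] -/
theorem limitExtension_hypersurfaceHodgeFourLowDegree_of_hodgeConjectureFor
    (h : ∀ ⦃n : ℕ⦄ ⦃X : SchemeOver ℂ⦄, IsSmoothProjective n X → HodgeConjectureFor n X) :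
    HypersurfaceHodgeFourLowDegree := by
  unfold HypersurfaceHodgeFourLowDegree
  intro d X _ hX
  exact h hX.1

/-! ### Appended: the item from the two named facts

Once the Conte–Murre fact `hodgeTwoTwo_algebraic_quarticQuinticFourfold`
(`HodgeTheory/QuarticQuinticFourfoldHodgeClassesAlgebraic`: "[HC(·, 2)] is true for smooth
`V(3)`, `V(4)` and `V(5)` in `ℙ₅`", Murre, LNM 1594, Ch. V §5.3.1, after Conte–Murre 1978/1979) is in
the tree, `…_of_quintic` specialises to the item CLOSED MODULO the two named facts. -/

/-- **`HypersurfaceHodgeFourLowDegree` from the two printed theorems, both named facts of the tree: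
Bloch–Srinivas' Prop. 10.26 (`hBS`; degrees `d ≤ 4`: `ℙ⁴`, quadric, cubic, quartic — a line through
every point, `CH₀` supported on a hyperplane section, proved in the tree) and Conte–Murre (`hCM`;
degree `5`, the quintic fourfold `V(5) ⊂ ℙ₅`).** The other codimensions and the Hodge model are
theorems of the tree (`limitExtension_hypersurfaceHodgeFour_of_twoTwo`). This is the item modulo
exactly `BlochSrinivas1983_hodgeConjectureDegreeFour_of_chowZeroSupported` and
`hodgeTwoTwo_algebraic_quarticQuinticFourfold`.
[cite: VoisinHodgeII2003, Prop. 10.26 and the remark following it (§10.2.3)]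
[cite: MurreTorino1994, Ch. V §5.3.1, Theorem ([CM 1]) and Applications] [cite: ConteMurre1978] -/
theorem limitExtension_hypersurfaceHodgeFourLowDegree_of_facts
    (hBS : BlochSrinivas1983_hodgeConjectureDegreeFour_of_chowZeroSupported)
    (hCM : hodgeTwoTwo_algebraic_quarticQuinticFourfold) : HypersurfaceHodgeFourLowDegree :=
  limitExtension_hypersurfaceHodgeFourLowDegree_of_quintic hBS fun _ hX ↦ hCM (Or.inr rfl) hX

end Summit.HodgeConjecture.HodgeConjecture.Theorems

end
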